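import Literature.MathematicalPhysics.QuantumFieldTheory.Balaban1983to89.B4Lemma22HolderNoCollar
import Literature.MathematicalPhysics.QuantumFieldTheory.Balaban1983to89.B4Lemma22NoCollarContours

/-!
# `Balaban1983to89.B4Lemma22HolderNoCollarContours` — [Balaban1983RegularityDecay] LEMMA 2.2 (2.16), THE HÖLDER MEMBER, for
# `G_k(□, A)` at a (1.7)-REGULAR `A` WITH NO COLLAR, FOR A GENERAL CONTOUR SYSTEM `Γ^{(k)}_{y,x}` of the averaging (1.4)
# (r04 g15's `B4Lemma22HolderNoCollar.lemma22_holder_noCollar` is the case of the lineage's single staircase `stairContour`; the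
# (Higgs)₂,₃ model of [Balaban1982Higgs1] transports along the COMPOSITE contour (2.2), read on a sub-box of the torus through p35 gen 15's
# chart `B1TorusSubBoxChart.gammaB`)

statement-level skeleton of published theorems with citation tags; proofs where landed; nothing here is a claim about the Yang–Mills mass gap

CITATION HEADER (lean-in-tree rule).  T. Bałaban, *Regularity and decay of lattice Green's functions*, Commun. Math. Phys. **89** (1983)
571–597, doi:10.1007/bf01214744 [Balaban1983RegularityDecay] (cell paper B4; held text `paper:balaban1983-cmp89-regularity-decay`,
journal page = PDF page + 570; p. 572 (1.4)–(1.7), p. 575 «Ã_j = A», p. 577 Lemma 2.2 (2.16) with (2.14), p. 579 «we can apply Lemma 2.2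
to all operators in it», p. 581), and T. Bałaban, *(Higgs)₂,₃ quantum fields in a finite volume. I*, Commun. Math. Phys. **85** (1982)
603–626 [Balaban1982Higgs1] ((2.2) p. 608 the composite contour; Prop. 2.1 (2.24) p. 610 and p. 611 l.1–2 «For some simple sets Ω, e.g.
for rectangular parallelepipeds, the inequalities hold without any restrictions on the points x, x′»).  Cell `lit-balaban` (HOME
`run/shared/lean/pub/lit-balaban/`), Phase-2 proof seat **p35** gen 21 (unit `lit-balaban-p35`); SKELETON rows **B4.Lem2.2** ((2.16), the
Hölder member at the raw regular field, generic contour system — the form consumed by the (Higgs)₂,₃ carrier through the sub-box chart) and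
**B1.Prop2.1** / **B1.Eq2.24** (parallelepiped clause, the Hölder member).  USED BY NAME, never restated: r04 g15
`B4Lemma22HolderNoCollar.{lemma22_16_holder_field_explicit_face (GENERIC embedding and contour system), gauged_transverse,
holder_noCollar_threshold}`, `B4Lemma22BoxNoCollar.{gSig, gBond, bondGauge_gBond, gBond_step, gBond_hyps}`, r01's
`B4Lemma22Invertible.opA_isUnit_det` (invertibility for ANY contour system with `hnn`/`hend`), p35 gen 15's
`B4Lemma22NoCollarContours.contour_lsum_le` (`τ = (d+1)θ` for any nearest-neighbour system of length `≤ (d+1)n`),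
`B4Lemma22HolderCubeField.holder_gauge`, `B4GaugeCovariance.{b4Green_bondGauge, transport_gauge}`, `B4Lemma22ReduceZero.{covDeriv_gauge,
supN_gauge_transpose}`, `B4CubeFieldHyps22.{fieldLink_smul, greenA_smul, aSeq_window}`, `B4BoxNeumannGauge.{gauged, C1, C2}`.

WHAT IS PRINTED.  p. 577, Lemma 2.2 [PDF 7]: «‖G_k(□,Ã)f‖_{1,α} ≤ c₁‖f‖_∞ (2.16)» with the norm (2.14) of p. 577 (the `α`-Hölder quotient of
`D^η_Ã G f` formed with the transport `U(Ã(Γ_{x,x′}))`); p. 572 (1.4): «(Q_k(A)φ)(y) = Σ_{x∈B^k(y)} η^d U(A(Γ^{(k)}_{y,x}))φ(x)» — the contour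
`Γ^{(k)}_{y,x}` is the one of [Balaban1982Higgs1] (2.2); p. 575 [PDF 5] L22–24, verbatim: «where the configurations Ã_j are constructed in the
following way: if □_j intersects the boundary of Ω, then Ã_j = A; …»; p. 579 [PDF 9] L25–28, verbatim: «Finally let us notice that if Ω is
a rectangular parallelepiped, then all □_j in the representation (2.13) are cubes and we can apply Lemma 2.2 to all operators in it, so the
restriction dist({x, x′}, Ωᶜ) ≧ R₀ is unnecessary.»

WHY THIS FILE.  r04's no-collar Hölder member is assembled for the staircase contour system (`opA_stair_isUnit_det`, `stair_lsum_le`,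
`stairContour_end`); the (Higgs)₂,₃ carrier's `P_k(A) = Q_k^*(A)Q_k(A)` transports along the composite contour (2.2), which for `k ≥ 2` is a
different nearest-neighbour path.  r04's generic certificate `lemma22_16_holder_field_explicit_face` takes the embedding and the contour
system as parameters with the hypotheses «invertible», «ends at `x`» and a bound `τ` on `|κA′(Γ)|`; this file discharges them for ANY
nearest-neighbour system of length `≤ (d+1)·n` starting at the block corner (invertibility by r01's `opA_isUnit_det`, `τ = (d+1)θ` by
`contour_lsum_le`) and repeats r04's transverse-Lipschitz and gauge steps verbatim.  It is the generic input of the (2.24) Hölder member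
on cell-product BOXES of the torus with no `R₀` (p35's `B1TorusSubBoxHolderInput` / `B1Ineq224RegularBox`).

WHAT THIS MODULE PROVES (theorems only; no `def`, no `Prop` fact, no `sorry`; axioms standard).
* **`lemma22_holder_noCollar_contour`** — r04's `lemma22_holder_noCollar` with `stairContour hn M` replaced by any `Γ` with `hnn`
  (nearest-neighbour from `baseEmb hn M y`), `hend` (ends at `x` when `x ∈ B(y)`), `hlen` (`|Γ y x| ≤ (d+1)·n`): `∃ C > 0 ∀ (c,β) S ∃ e₁ > 0`
  such that for every box `Π[0,nM_μ)` (`1 ≤ M_μ ≤ S`, `nM_μ ≥ 3`), every component field `A` (1.7)-regular on the box, `0 < e ≤ e₁`, every `μ`,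
  sites `x ≠ x′` whose forward `μ`-bonds lie in `□`, every nearest-neighbour chain `Γ` from `x` to `x′` with `|Γ| ≤ (d+1)|x′−x|_∞`, every `Φ`:
  `(n/|x′−x|_∞)^α·|U(A(Γ))(D^η_{A,μ}G_k(□,A)Φ)(x′) − (D^η_{A,μ}G_k(□,A)Φ)(x)| ≤ C‖Φ‖_∞` (`0 ≤ α < 1`, coupling `e/n`).
HONEST SCOPE.  Exactly r04 g15's scope (the Hölder member (2.16) at the raw (1.7)-regular field; `d`, `N`, the flow, `L ≥ 2`, the windows
`[a₋,a₊]`, `[0, m²₊]`; the gauge `λ` of `B4BoxNeumannGauge`; chains with `|Γ| ≤ (d+1)|x′−x|_∞`), for a contour-system PARAMETER; the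
staircase case is r04's theorem (not re-derived here).  Unit `lit-balaban-p35` gen 21 (literature-prover-lit-balaban-p35-g21-0).
-/

namespace Literature.MathematicalPhysics.QuantumFieldTheory.Balaban1983to89.B4Lemma22HolderNoCollarContours

open Finset Matrix
open Literature.MathematicalPhysics.QuantumFieldTheory.Balaban1983to89.B4GaugeCovariance
open Literature.MathematicalPhysics.QuantumFieldTheory.Balaban1983to89.B4Reflection242 (boxDom nbrs mem_boxDom mem_nbrs)
open Literature.MathematicalPhysics.QuantumFieldTheory.Balaban1983to89.B4Lower18Regular (e1 baseEmb pathEnd_stair lsum PathRel)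
open Literature.MathematicalPhysics.QuantumFieldTheory.Balaban1983to89.B4Lower18RegularRegion (compField)
open Literature.MathematicalPhysics.QuantumFieldTheory.Balaban1983to89.B4Lemma21Region (siteNorm covDeriv)
open Literature.MathematicalPhysics.QuantumFieldTheory.Balaban1983to89.B4ContourShift (supNorm supNorm_nonneg)
open Literature.MathematicalPhysics.QuantumFieldTheory.Balaban1983to89.B4Lemma22Reduce231 (supN supN_nonneg)
open Literature.MathematicalPhysics.QuantumFieldTheory.Balaban1983to89.B4Lemma22ReduceZero (Box opA greenA derivA
  supN_gauge_transpose covDeriv_gauge)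
open Literature.MathematicalPhysics.QuantumFieldTheory.Balaban1983to89.B4Lemma22Invertible (opA_isUnit_det)
open Literature.MathematicalPhysics.QuantumFieldTheory.Balaban1983to89.B4Lemma22HolderBox (IsNNChain)
open Literature.MathematicalPhysics.QuantumFieldTheory.Balaban1983to89.B4Lemma22HolderCubeField (holder_gauge)
open Literature.MathematicalPhysics.QuantumFieldTheory.Balaban1983to89.B4CubeFieldHyps22 (fieldLink_smul greenA_smul aSeq_window)
open Literature.MathematicalPhysics.QuantumFieldTheory.Balaban1983to89.B4BoxNeumannGauge (gauged C1 C2)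
open Literature.MathematicalPhysics.QuantumFieldTheory.Balaban1983to89.B4Lemma22BoxNoCollar (gSig gBond bondGauge_gBond gBond_step
  gBond_hyps)
open Literature.MathematicalPhysics.QuantumFieldTheory.Balaban1983to89.B4Lemma22HolderNoCollar (lemma22_16_holder_field_explicit_face
  gauged_transverse holder_noCollar_threshold)
open Literature.MathematicalPhysics.QuantumFieldTheory.Balaban1983to89.B4Lemma22NoCollarContours (contour_lsum_le)

noncomputable section

variable {d : ℕ}

section Main

variable {ι : Type} [Fintype ι] [DecidableEq ι]

/-- `C₁(d) ≥ 0`. [cite: Balaban1983RegularityDecay, (1.7) p. 572, dictionary] -/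
private theorem C1_nn (d : ℕ) : 0 ≤ C1 d := by unfold C1; positivity

/-- `C₂(d) ≥ 0`. [cite: Balaban1983RegularityDecay, (1.7) p. 572, dictionary] -/
private theorem C2_nn (d : ℕ) : 0 ≤ C2 d := by unfold C2; positivity

/-- the zero constant configuration is the zero bond function. [cite: Balaban1983RegularityDecay, p. 581 «constant configurations A₀», dictionary] -/
private theorem constBond_zero' {X : Type*} (pos : X → Fin (d + 1) → ℤ) :
    constBond (0 : Fin (d + 1) → ℝ) pos = 0 := by
  funext u v
  simp [constBond]

set_option maxHeartbeats 800000 in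
/-- **LEMMA 2.2 (2.16), THE HÖLDER MEMBER, FOR `G_k(□, A)` AT THE FIELD `A` ITSELF, (1.7)-REGULAR ON THE BOX, WITH NO COLLAR, FOR A GENERAL
CONTOUR SYSTEM** (the print's boundary-cube choice «Ã_j = A», p. 575, on a parallelepiped, p. 579; the averaging (1.4) along any
nearest-neighbour contours `Γ^{(k)}_{y,x}` from the block corner `n·y` to `x ∈ B(y)` of length `≤ (d+1)n` — e.g. the composite contour (2.2) of
[Balaban1982Higgs1]): there is `C > 0` (for `0 ≤ α < 1`; Lemma 2.2 at charge `1`) such that for every regularity pair `(c, β)`, `β > 0`, and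
side bound `S` there is `e₁ > 0` with: for every mesh `n = L^k`, every `a, m²` of the windows, every box `□ = Π_μ[0, nM_μ)` (`1 ≤ M_μ ≤ S`,
`nM_μ ≥ 3`), every such contour system, EVERY component field `A` with `|A_ν(x + e_μ) − A_ν(x)| ≤ ce^{β−1}/n` for `x ∈ □` (nothing at the
boundary), every charge `0 < e ≤ e₁`, every direction `μ`, sites `x ≠ x′` whose forward `μ`-bonds lie in `□`, every nearest-neighbour chain
`Γ` from `x` to `x′` with `|Γ| ≤ (d+1)|x′ − x|_∞` and every `Φ`:
`(n/|x′ − x|_∞)^α·|U(A(Γ))(D^η_{A,μ}G_k(□,A)Φ)(x′) − (D^η_{A,μ}G_k(□,A)Φ)(x)| ≤ C‖Φ‖_∞` at coupling `e/n` (corner embedding).  Proof = r04's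
`lemma22_holder_noCollar`: §1 face certificate at `A₀ = 0`, `A′ = (e/n)A″` (`gBond_hyps`), transverse Lipschitz by `gauged_transverse`,
invertibility by `opA_isUnit_det`, `τ = (d+1)θ` by `contour_lsum_le`, then the gauge step `A = (A″)^λ` (`holder_gauge`, `transport_gauge`,
`covDeriv_gauge`, `b4Green_bondGauge`).
[cite: Balaban1983RegularityDecay, Lemma 2.2 (2.16) p. 577 with (2.14) p. 577, p. 579 «we can apply Lemma 2.2 to all operators in it», (1.4) p. 572, (1.7) p. 572, p. 581]
[cite: Balaban1982Higgs1, (2.2) p. 608, Prop. 2.1 (2.24) p. 610, p. 611 l.1–2] -/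
theorem lemma22_holder_noCollar_contour (F : OrthFlow ι) {ℓ₁ : ℝ} (hℓ₁ : 0 ≤ ℓ₁)
    (hLip : ∀ t (v : ι → ℝ), ((F.U t - 1) *ᵥ v) ⬝ᵥ ((F.U t - 1) *ᵥ v) ≤ (ℓ₁ * t) ^ 2 * (v ⬝ᵥ v))
    (d ℓ : ℕ) (hℓ : 1 ≤ ℓ) (amin aplus m2plus : ℝ) (ha : 0 < amin) (α : ℝ) (hα0 : 0 ≤ α) (hα1 : α < 1) :
    ∃ C : ℝ, 0 < C ∧ ∀ (creg β : ℝ), 0 ≤ creg → 0 < β → ∀ (S : ℕ),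
      ∃ e₁ : ℝ, 0 < e₁ ∧ ∀ (k : ℕ), 1 ≤ k → ∀ (hn : 1 ≤ (ℓ + 1) ^ k) (a m2 : ℝ),
      amin ≤ a → a ≤ aplus → 0 ≤ m2 → m2 ≤ m2plus →
      ∀ (M : Fin (d + 1) → ℕ), (∀ i, 1 ≤ M i) → (∀ i, M i ≤ S) → (∀ i, 3 ≤ (ℓ + 1) ^ k * M i) →
      ∀ (Γ : ↥(boxDom M) → ↥(Box d ℓ k M) → List ↥(Box d ℓ k M)),
        (∀ y x, PathRel (fun u v : ↥(Box d ℓ k M) => v.1 ∈ nbrs u.1) (baseEmb hn M y) (Γ y x)) →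
        (∀ y x, blkWt ((ℓ + 1) ^ k) M (fun i => (ℓ + 1) ^ k * M i) y x ≠ 0 → pathEnd (baseEmb hn M y) (Γ y x) = x) →
        (∀ y x, ((Γ y x).length : ℝ) ≤ ((d : ℝ) + 1) * (((ℓ + 1) ^ k : ℕ) : ℝ)) →
      ∀ (Ac : (Fin (d + 1) → ℤ) → Fin (d + 1) → ℝ) (e : ℝ), 0 < e → e ≤ e₁ →
        (∀ x ∈ Box d ℓ k M, ∀ μ ν : Fin (d + 1),
          |Ac (x + e1 μ) ν - Ac x ν| ≤ creg * e ^ (β - 1) / ((ℓ + 1) ^ k : ℕ)) →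
      ∀ (μ : Fin (d + 1)) (x xe x' xe' : ↥(Box d ℓ k M)),
        xe.1 = x.1 + e1 μ → xe'.1 = x'.1 + e1 μ → x'.1 ≠ x.1 →
      ∀ (l : List ↥(Box d ℓ k M)), IsNNChain x l → pathEnd x l = x' →
        (l.length : ℝ) ≤ ((d : ℝ) + 1) * supNorm (x'.1 - x.1) →
      ∀ Φ : ↥(Box d ℓ k M) × ι → ℝ,
        ((((ℓ + 1) ^ k : ℕ) : ℝ) / supNorm (x'.1 - x.1)) ^ α *
          siteNorm (transport (fieldLink F (e / ((ℓ + 1) ^ k : ℕ))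
                (fun u v : ↥(Box d ℓ k M) => compField Ac u.1 v.1)) x l
              *ᵥ fld (derivA d F (e / ((ℓ + 1) ^ k : ℕ)) ℓ k M
                      (fun u v : ↥(Box d ℓ k M) => compField Ac u.1 v.1) μ
                    *ᵥ (greenA d F (e / ((ℓ + 1) ^ k : ℕ)) ℓ k a m2 M (baseEmb hn M) Γ
                        (fun u v : ↥(Box d ℓ k M) => compField Ac u.1 v.1) *ᵥ Φ)) x'
            - fld (derivA d F (e / ((ℓ + 1) ^ k : ℕ)) ℓ k M
                      (fun u v : ↥(Box d ℓ k M) => compField Ac u.1 v.1) μ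
                    *ᵥ (greenA d F (e / ((ℓ + 1) ^ k : ℕ)) ℓ k a m2 M (baseEmb hn M) Γ
                        (fun u v : ↥(Box d ℓ k M) => compField Ac u.1 v.1) *ᵥ Φ)) x)
          ≤ C * supN Φ := by
  obtain ⟨c, c₁, hc, hc₁, hL⟩ :=
    lemma22_16_holder_field_explicit_face F hℓ₁ hLip 1 d ℓ hℓ amin aplus m2plus ha α hα0 hα1
  refine ⟨2 * c₁, by positivity, fun creg β hcreg hβ S => ?_⟩
  obtain ⟨e₁, he₁, hth⟩ := holder_noCollar_threshold d (c := c) (aplus := aplus) hℓ₁ hc.le ha hcreg hβ S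
  refine ⟨e₁, he₁, ?_⟩
  intro k hk hn a m2 e1' e2 e3 e4 M hM hS hN3 Γ hnn hend hlen Ac e he hle h17 μ x xe x' xe' hxe hxe' hne l hl hlend hlenl Φ
  have hnr : (0 : ℝ) < ((ℓ + 1) ^ k : ℕ) := by exact_mod_cast hn
  obtain ⟨hak1, hak2⟩ := aSeq_window hℓ hk ha e1' e2
  obtain ⟨hθ1, hθT1, hsm2, hsm⟩ := hth e he hle _ hak1 hak2
  obtain ⟨-, hA', hder, hface⟩ := gBond_hyps (d := d) hn hS hN3 hcreg he h17
  set n : ℕ := (ℓ + 1) ^ k with hn_def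
  set A' : ↥(Box d ℓ k M) → ↥(Box d ℓ k M) → ℝ := gBond (e / n) (fun i => n * M i) Ac with hA'_def
  set θ : ℝ := (C2 d + S * C1 d) * creg * e ^ β with hθ_def
  set θ₂ : ℝ := C1 d * creg * e ^ β with hθ₂_def
  set θf : ℝ := C2 d * creg * e ^ β with hθf_def
  set θT : ℝ := 2 * ((d : ℝ) + 1) * C1 d * creg * e ^ β with hθT_def
  have hC1n := C1_nn d
  have hC2n := C2_nn d
  have heβ : 0 < e ^ β := Real.rpow_pos_of_pos he β
  have hθ0 : 0 ≤ θ := by rw [hθ_def]; positivity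
  have hθ₂0 : 0 ≤ θ₂ := by rw [hθ₂_def]; positivity
  have hθf0 : 0 ≤ θf := by rw [hθf_def]; positivity
  have hθT0 : 0 ≤ θT := by rw [hθT_def]; positivity
  have ha' : 0 < a := lt_of_lt_of_le ha e1'
  -- invertibility at the gauged field, for ANY contour system with `hnn`/`hend` (r01)
  have hunit : IsUnit (opA d F 1 ℓ k a m2 M (baseEmb hn M) Γ
      (constBond (0 : Fin (d + 1) → ℝ) Subtype.val + A')).det :=
    opA_isUnit_det F 1 hℓ hk ha' e3 M (fun y x _ => hnn y x) hend _
  -- the vacuous size of the zero constant part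
  have hA0 : ∀ ν, |1 * (0 : Fin (d + 1) → ℝ) ν| ≤ θ / ((ℓ + 1) ^ k : ℕ) := fun ν => by
    rw [Pi.zero_apply, mul_zero, abs_zero]; positivity
  -- the transverse Lipschitz bound (r04 §2) at charge `e/n`
  set κr : ℝ := creg * e ^ (β - 1) / n with hκr
  have hκr0 : 0 ≤ κr := by
    have := Real.rpow_pos_of_pos he (β - 1); rw [hκr]; positivity
  have hen : 0 < e / n := div_pos he hnr
  have hkey : e / n * κr = creg * e ^ β / (n : ℝ) ^ 2 := by
    rw [hκr, Real.rpow_sub_one he.ne']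
    field_simp
  have hA'' : ∀ (ν : Fin (d + 1)) (u ue u' ue' : ↥(Box d ℓ k M)), ue.1 = u.1 + e1 ν → ue'.1 = u'.1 + e1 ν →
      |1 * (A' u' ue' - A' u ue)| ≤ θT * supNorm (u'.1 - u.1) / (((ℓ + 1) ^ k : ℕ) : ℝ) ^ 2 := by
    intro ν u ue u' ue' hue hue'
    have hb := gauged_transverse hN3 hκr0 h17 ν u.2 (hue ▸ ue.2) u'.2 (hue' ▸ ue'.2)
    rw [one_mul, hA'_def, gBond_step hue', gBond_step hue, ← mul_sub, abs_mul, abs_of_pos hen]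
    calc e / n * |gauged (fun i => n * M i) Ac u'.1 ν - gauged (fun i => n * M i) Ac u.1 ν|
        ≤ e / n * (2 * (((d : ℝ) + 1) * supNorm (u'.1 - u.1)) * (C1 d * κr)) :=
          mul_le_mul_of_nonneg_left hb hen.le
      _ = 2 * ((d : ℝ) + 1) * C1 d * (e / n * κr) * supNorm (u'.1 - u.1) := by ring
      _ = θT * supNorm (u'.1 - u.1) / (n : ℝ) ^ 2 := by rw [hkey, hθT_def]; ring
  -- the contour sums along ANY nearest-neighbour system of length `≤ (d+1)n` (p35 gen 15)
  have hτ : ∀ y x, blkWt ((ℓ + 1) ^ k) M (fun i => (ℓ + 1) ^ k * M i) y x ≠ 0 →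
      |1 * lsum A' (baseEmb hn M y) (Γ y x)| ≤ ((d : ℝ) + 1) * θ :=
    fun y x _ => contour_lsum_le 1 hn M hnn hlen hθ0 hA' y x
  have hτ0 : 0 ≤ ((d : ℝ) + 1) * θ := by positivity
  -- the gauge that takes `A''` back to `A`
  set g : ↥(Box d ℓ k M) → Matrix ι ι ℝ := fun u => F.U (1 * gSig (e / n) (fun i => n * M i) Ac u) with hg_def
  have hg : IsGauge g := F.isGauge _
  -- r04's certificate at charge 1, constant part 0, fluctuation `A'`, source `𝒢ᵀΦ`
  have main := hL k hk a m2 e1' e2 e3 e4 M hM (baseEmb hn M) Γ hend 0 A' θ θT θ₂ θf (((d : ℝ) + 1) * θ)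
    hunit hθ0 hθ1 hA0 hA' hθT0 hθT1 hA'' hθ₂0 hder hθf0 hface hτ0 hτ hsm μ x xe x' xe' hxe hxe' hne l hl hlend hlenl
    ((blockDiag g)ᵀ *ᵥ Φ)
  rw [constBond_zero', zero_add, supN_gauge_transpose hg] at main
  -- put back the charge and the gauge: `(e/n)A = (A')^{σ}`
  have hfield : (fun u v : ↥(Box d ℓ k M) => e / n * compField Ac u.1 v.1)
      = bondGauge (gSig (e / n) (fun i => n * M i) Ac) A' :=
    (bondGauge_gBond (e / n) (fun i => n * M i) Ac).symm
  have hW : fieldLink F (e / n) (fun u v : ↥(Box d ℓ k M) => compField Ac u.1 v.1)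
      = gaugeKer g g (fieldLink F 1 A') := by
    rw [fieldLink_smul, hfield, fieldLink_bondGauge]
  have hTr : transport (fieldLink F (e / n) (fun u v : ↥(Box d ℓ k M) => compField Ac u.1 v.1)) x l
      = g x * transport (fieldLink F 1 A') x l * (g x')ᵀ := by
    rw [hW, transport_gauge hg, hlend]
  have hDer : derivA d F (e / n) ℓ k M (fun u v : ↥(Box d ℓ k M) => compField Ac u.1 v.1) μ
      = blockDiag g * derivA d F 1 ℓ k M A' μ * (blockDiag g)ᵀ := by
    unfold derivA
    rw [hW, covDeriv_gauge hg]
  have hGr : greenA d F (e / n) ℓ k a m2 M (baseEmb hn M) Γ (fun u v : ↥(Box d ℓ k M) => compField Ac u.1 v.1)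
      = blockDiag g * greenA d F 1 ℓ k a m2 M (baseEmb hn M) Γ A' * (blockDiag g)ᵀ := by
    rw [greenA_smul, hfield]
    unfold greenA
    rw [b4Green_bondGauge F 1 _ m2 _ hend]
  rw [hTr, hDer, hGr, holder_gauge hg]
  exact main

end Main

end

end Literature.MathematicalPhysics.QuantumFieldTheory.Balaban1983to89.B4Lemma22HolderNoCollarContours
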